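import Summits.Ventures.MM22.Rank333.GF2ProfileRowsSub
import HarnessLib

/-!
# Cell pub-mm22 — a kernel checker for PROFILE CENSUSES with open leaves (counting DFS with Farkas leaf certificates)

Cell `pub-mm22` (MatrixMultiplication venture; HOME `run/shared/lean/pub/pub-mm22/`; seat engine-1 g9), topic
`Summits/Ventures/MM22`.
HONEST FRAMING: checker PLUMBING with its soundness theorem — not a bound and not a result.  It is the kernel form of the
cell's «term-profile census» step (engine-2 profdfs / bench / referee for E3; c1census for C1): given a profile
`prof : Fin N → ℕ` valued in a duplicate-free ordered candidate list `ord` and satisfying row inequalities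
`#{i : prof i ∈ M_r} ≤ cap_r`, a DFS over the multiplicities of the candidates (in the order of `ord`) whose dead branches
carry INTEGER FARKAS certificates (nonnegative row multipliers `y_r` covering every undecided candidate `≥ D` times with
`∑ y_r cap_r < D · R + ∑ y_r · decidedInside_r`, `R` = undecided mass) and whose surviving leaves are EXPLICIT count vectors
(«open leaves») proves that the profile is a permutation of one of the listed open profiles (`CNode.sound`).  Pure
counting over `ℕ`; the rows' validity is the consumer's input (for E3: `ValidAllSub` rows transported from the kernel
table, `Psi10Census.lean`).
-/

namespace Summit.Ventures.MM22.GF2Cert.Census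

open Summit.MatrixMultiplication.OmegaCensus.GF2RankLB
open Summit.Ventures.MM22.GF2Cert.Profile

/-! ## Certificate format and the check -/

/-- A row: member patterns and the cap `#{i : prof i ∈ members} ≤ cap`. -/
structure Row where
  /-- member patterns -/
  members : List ℕ
  /-- cap -/
  cap : ℕ

/-- The default row (unused index). -/
instance : Inhabited Row := ⟨⟨[], 0⟩⟩

/-- Census trees. Children of `node` are indexed by the multiplicity `v` of the next candidate (`W` slots). -/
inductive CNode (W : ℕ) : Type
  /-- dead branch: Farkas certificate `(row index, multiplier)` list and the coverage `D` -/
  | leaf (ys : List (ℕ × ℕ)) (D : ℕ) : CNode W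
  /-- dead branch: all candidates decided but the count is short -/
  | short : CNode W
  /-- open leaf: the count vector is that of the open profile `pi` -/
  | opn (pi : ℕ) : CNode W
  /-- branch on the multiplicity of the next candidate -/
  | node (kids : Fin W → CNode W) : CNode W
  /-- always fails (default child) -/
  | fail : CNode W

/-- Indicator-weighted sum over the DECIDED positions: `∑_{j < |counts|, ord[j] ∈ M} counts[j]`. -/
def assignedInside (ord : List ℕ) (counts : List ℕ) (r : Row) : ℕ :=
  ((List.range counts.length).map fun j => if ord.getD j 0 ∈ r.members then counts.getD j 0 else 0).sum

/-- Coverage of candidate `g` by the certificate: `∑_{(r,y) ∈ ys, g ∈ M_r} y`. -/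
def coverage (rows : List Row) (ys : List (ℕ × ℕ)) (g : ℕ) : ℕ :=
  (ys.map fun ry => if g ∈ (rows.getD ry.1 default).members then ry.2 else 0).sum

/-- **The replay check** of a census tree at the decided prefix `counts`. -/
def CNode.check (rows : List Row) (ord : List ℕ) (phs : List (List ℕ)) (N : ℕ) {W : ℕ} :
    CNode W → List ℕ → Bool
  | .leaf ys D, counts =>
      decide (counts.sum ≤ N) && decide (counts.length ≤ ord.length) &&
      ys.all (fun ry => decide (ry.1 < rows.length)) &&
      (ord.drop counts.length).all (fun g => decide (D ≤ coverage rows ys g)) &&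
      decide ((ys.map fun ry => ry.2 * (rows.getD ry.1 default).cap).sum <
        D * (N - counts.sum) + (ys.map fun ry => ry.2 * assignedInside ord counts (rows.getD ry.1 default)).sum)
  | .short, counts => decide (counts.length = ord.length) && decide (counts.sum < N)
  | .opn pi, counts =>
      decide (pi < phs.length) && decide (counts.sum = N) && decide (counts.length ≤ ord.length) &&
      (phs.getD pi []).all (fun g => decide (g ∈ ord)) &&
      (List.range ord.length).all (fun j => (phs.getD pi []).count (ord.getD j 0) == counts.getD j 0)
  | .node kids, counts =>
      decide (counts.length < ord.length) && decide (counts.sum ≤ N) &&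
      decide (∀ v : Fin W, v.1 ≤ N - counts.sum → (kids v).check rows ord phs N (counts ++ [v.1]) = true)
  | .fail, _ => false

/-- Data helper: children from a list (missing ↦ `fail`). -/
def CN {W : ℕ} (kids : List (CNode W)) : CNode W := .node fun v => kids.getD v.1 .fail

/-! ## Counting lemmas -/

section Counting

variable {N : ℕ} (prof : Fin N → ℕ)

/-- The multiplicity of a value in the profile. -/
def cnt (g : ℕ) : ℕ := (List.ofFn prof).count g

/-- `#{i : P (prof i)} = countP P (ofFn prof)`. -/
theorem card_filter_eq_countP' (P : ℕ → Bool) :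
    (Finset.univ.filter fun i => P (prof i) = true).card = (List.ofFn prof).countP P := by
  induction N with
  | zero => simp
  | succ N ih =>
    have h1 := ih (fun i => prof i.succ)
    rw [Finset.card_filter] at h1 ⊢
    rw [Fin.sum_univ_succ, List.ofFn_succ, List.countP_cons, ← h1]
    by_cases h : P (prof 0) = true <;> simp [h, Nat.add_comm]

/-- `#{i : prof i = g} = cnt g`. -/
theorem card_eq_cnt (g : ℕ) : (Finset.univ.filter fun i => prof i = g).card = cnt prof g := by
  rw [cnt, List.count, ← card_filter_eq_countP' prof (· == g)]
  congr 1
  ext i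
  simp

/-- `#{i : prof i ∈ M} = ∑_{g ∈ M} cnt g` for a duplicate-free `M`. -/
theorem card_mem_eq_sum : ∀ (M : List ℕ), M.Nodup →
    (Finset.univ.filter fun i => prof i ∈ M).card = (M.map (cnt prof)).sum
  | [], _ => by simp
  | g :: M, hnd => by
    classical
    have hg : g ∉ M := (List.nodup_cons.1 hnd).1
    have hM : M.Nodup := (List.nodup_cons.1 hnd).2
    rw [List.map_cons, List.sum_cons, ← card_mem_eq_sum M hM, ← card_eq_cnt]
    rw [← Finset.card_union_of_disjoint]
    · congr 1
      ext i
      simp [Finset.mem_union, Finset.mem_filter]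
    · rw [Finset.disjoint_filter]
      intro i _ hi hiM
      exact hg (hi ▸ hiM)

/-- `∑_{g ∈ S} cnt g = N` when every value lies in the duplicate-free list `S`. -/
theorem sum_cnt_eq (S : List ℕ) (hS : S.Nodup) (hprof : ∀ i, prof i ∈ S) : (S.map (cnt prof)).sum = N := by
  rw [← card_mem_eq_sum prof S hS]
  have : (Finset.univ.filter fun i => prof i ∈ S) = Finset.univ := by
    ext i; simp [hprof i]
  rw [this, Finset.card_univ, Fintype.card_fin]

/-- Values outside `S` have multiplicity `0`. -/
theorem cnt_eq_zero_of_not_mem {S : List ℕ} (hprof : ∀ i, prof i ∈ S) {g : ℕ} (hg : g ∉ S) : cnt prof g = 0 := by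
  rw [cnt, List.count_eq_zero]
  intro h
  rw [List.mem_ofFn] at h
  obtain ⟨i, hi⟩ := h
  exact hg (hi ▸ hprof i)

end Counting

/-! ## List-sum bookkeeping -/

/-- Swapping a double list sum. -/
theorem sum_map_sum_map_comm {α β : Type*} (l₁ : List α) (l₂ : List β) (f : α → β → ℕ) :
    (l₁.map fun a => (l₂.map fun b => f a b).sum).sum = (l₂.map fun b => (l₁.map fun a => f a b).sum).sum := by
  induction l₁ with
  | nil => simp
  | cons a l₁ ih =>
    simp only [List.map_cons, List.sum_cons, ih]
    rw [← List.sum_map_add]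

/-- Filtering and summing: `∑_{a ∈ l, p a} f a = ∑_{a ∈ l} [p a] f a`. -/
theorem sum_map_filter_eq {α : Type*} (l : List α) (p : α → Bool) (f : α → ℕ) :
    ((l.filter p).map f).sum = (l.map fun a => if p a then f a else 0).sum := by
  induction l with
  | nil => simp
  | cons a l ih =>
    by_cases h : p a = true
    · simp [h, ih]
    · simp [h, ih]

/-- Inside-count of a row over a candidate list: `∑_{g ∈ L, g ∈ M} cnt g`. -/
def insideOver {N : ℕ} (prof : Fin N → ℕ) (L : List ℕ) (r : Row) : ℕ :=
  (L.map fun g => if g ∈ r.members then cnt prof g else 0).sum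

/-- The inside-count over a duplicate-free list is at most the full inside-count `#{i : prof i ∈ M}`. -/
theorem insideOver_le_card {N : ℕ} (prof : Fin N → ℕ) (L : List ℕ) (hL : L.Nodup) (r : Row) :
    insideOver prof L r ≤ (Finset.univ.filter fun i => prof i ∈ r.members).card := by
  classical
  unfold insideOver
  have h1 : (L.map fun g => if g ∈ r.members then cnt prof g else 0).sum =
      ((L.filter fun g => decide (g ∈ r.members)).map (cnt prof)).sum := by
    rw [sum_map_filter_eq]
    refine congrArg List.sum (List.map_congr_left fun g _ => ?_)
    by_cases h : g ∈ r.members <;> simp [h]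
  rw [h1]
  have hnd : (L.filter fun g => decide (g ∈ r.members)).Nodup := hL.filter _
  rw [← card_mem_eq_sum prof _ hnd]
  refine Finset.card_le_card fun i hi => ?_
  simp only [Finset.mem_filter, Finset.mem_univ, true_and, List.mem_filter, decide_eq_true_eq] at hi ⊢
  exact hi.2

/-- Splitting the inside-count along an append. -/
theorem insideOver_append {N : ℕ} (prof : Fin N → ℕ) (L₁ L₂ : List ℕ) (r : Row) :
    insideOver prof (L₁ ++ L₂) r = insideOver prof L₁ r + insideOver prof L₂ r := by
  simp [insideOver, List.map_append, List.sum_append]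

/-- The prefix of a list as a map over positions. -/
theorem take_eq_map_range (ord : List ℕ) {k : ℕ} (hk : k ≤ ord.length) :
    ord.take k = (List.range k).map fun j => ord.getD j 0 := by
  apply List.ext_getElem
  · simp [List.length_take, min_eq_left hk]
  · intro j h1 h2
    rw [List.length_take, min_eq_left hk] at h1
    simp only [List.getElem_take, List.getElem_map, List.getElem_range]
    exact (List.getD_eq_getElem _ _ (lt_of_lt_of_le h1 hk)).symm

/-- Later entries lie in the dropped suffix. -/
theorem getElem_mem_drop (L : List ℕ) {k j : ℕ} (hk : k ≤ j) (hj : j < L.length) : L[j] ∈ L.drop k := by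
  have hlen : j - k < (L.drop k).length := by simp; omega
  have : (L.drop k)[j - k] = L[j] := by simp [List.getElem_drop, Nat.add_sub_cancel' hk]
  rw [← this]
  exact List.getElem_mem hlen

/-! ## Soundness -/

/-- The decided prefix `counts` **matches** the profile: `counts[j] = cnt (ord[j])`. -/
def Matches {N : ℕ} (prof : Fin N → ℕ) (ord counts : List ℕ) : Prop :=
  counts.length ≤ ord.length ∧ ∀ j < counts.length, counts.getD j 0 = cnt prof (ord.getD j 0)

section Sound

variable {N : ℕ} (rows : List Row) (ord : List ℕ) (hord : ord.Nodup) (phs : List (List ℕ))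
  (prof : Fin N → ℕ) (hprof : ∀ i, prof i ∈ ord)
  (hrows : ∀ r ∈ rows, (Finset.univ.filter fun i => prof i ∈ r.members).card ≤ r.cap)

/-- Under `Matches`, `counts.sum = ∑_{g ∈ ord.take k} cnt g`. -/
theorem sum_counts_eq {counts : List ℕ} (h : Matches prof ord counts) :
    counts.sum = ((ord.take counts.length).map (cnt prof)).sum := by
  rw [take_eq_map_range ord h.1, List.map_map]
  have : counts = (List.range counts.length).map fun j => counts.getD j 0 := by
    apply List.ext_getElem (by simp)
    intro j h1 h2
    simp only [List.getElem_map, List.getElem_range]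
    exact (List.getD_eq_getElem _ _ h1).symm
  conv_lhs => rw [this]
  refine congrArg List.sum (List.map_congr_left fun j hj => ?_)
  rw [List.mem_range] at hj
  simpa using h.2 j hj

/-- Under `Matches`, the decided inside-count is `insideOver` of the decided candidates. -/
theorem assignedInside_eq {counts : List ℕ} (h : Matches prof ord counts) (r : Row) :
    assignedInside ord counts r = insideOver prof (ord.take counts.length) r := by
  unfold assignedInside insideOver
  rw [take_eq_map_range ord h.1, List.map_map]
  refine congrArg List.sum (List.map_congr_left fun j hj => ?_)
  rw [List.mem_range] at hj
  simp only [Function.comp_apply]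
  split
  · exact h.2 j hj
  · rfl

include hord hprof in
/-- The undecided mass: `N − counts.sum = ∑_{g ∈ ord.drop k} cnt g`. -/
theorem undecided_mass_eq {counts : List ℕ} (h : Matches prof ord counts) :
    N - counts.sum = ((ord.drop counts.length).map (cnt prof)).sum := by
  have htot := sum_cnt_eq prof ord hord hprof
  rw [← List.take_append_drop counts.length ord, List.map_append, List.sum_append,
    ← sum_counts_eq ord prof h] at htot
  omega

include hord hprof hrows in
/-- **Soundness of the census check.** -/
theorem CNode.sound : ∀ (c : CNode (N + 1)) (counts : List ℕ), Matches prof ord counts →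
    c.check rows ord phs N counts = true → ∃ ph ∈ phs, (List.ofFn prof).Perm ph := by
  classical
  intro c
  induction c with
  | leaf ys D =>
    intro counts hm hc
    exfalso
    simp only [CNode.check, Bool.and_eq_true, decide_eq_true_eq, List.all_eq_true] at hc
    obtain ⟨⟨⟨⟨hsum, hlen⟩, hidx⟩, hcov⟩, hlt⟩ := hc
    have hR := undecided_mass_eq ord hord prof hprof hm
    -- each cited row: y cap ≥ y (assignedInside + insideOver U)
    have hrow : ∀ ry ∈ ys, ry.2 * (rows.getD ry.1 default).cap ≥
        ry.2 * assignedInside ord counts (rows.getD ry.1 default) + ry.2 * insideOver prof (ord.drop counts.length) (rows.getD ry.1 default) := by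
      intro ry hry
      have hi : ry.1 < rows.length := hidx ry hry
      have hmem : rows.getD ry.1 default ∈ rows := by
        rw [List.getD_eq_getElem _ _ hi]; exact List.getElem_mem hi
      have h1 := hrows _ hmem
      have h2 := insideOver_le_card prof ord hord (rows.getD ry.1 default)
      rw [← List.take_append_drop counts.length ord, insideOver_append, ← assignedInside_eq ord prof hm] at h2
      rw [← Nat.mul_add]
      exact Nat.mul_le_mul_left _ (by omega)
    have hsum1 : (ys.map fun ry => ry.2 * (rows.getD ry.1 default).cap).sum ≥
        (ys.map fun ry => ry.2 * assignedInside ord counts (rows.getD ry.1 default)).sum +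
        (ys.map fun ry => ry.2 * insideOver prof (ord.drop counts.length) (rows.getD ry.1 default)).sum := by
      rw [← List.sum_map_add]
      exact List.sum_le_sum hrow
    -- swap: ∑_ys y · insideOver U = ∑_{g ∈ U} cnt g · coverage g ≥ D · R
    have hswap : (ys.map fun ry => ry.2 * insideOver prof (ord.drop counts.length) (rows.getD ry.1 default)).sum =
        ((ord.drop counts.length).map fun g => cnt prof g * coverage rows ys g).sum := by
      simp only [insideOver, coverage, ← List.sum_map_mul_left]
      rw [sum_map_sum_map_comm]
      refine congrArg List.sum (List.map_congr_left fun g _ => congrArg List.sum (List.map_congr_left fun ry _ => ?_))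
      split <;> simp [Nat.mul_comm]
    have hcovsum : ((ord.drop counts.length).map fun g => cnt prof g * coverage rows ys g).sum ≥ ((ord.drop counts.length).map fun g => cnt prof g * D).sum :=
      List.sum_le_sum fun g hg => Nat.mul_le_mul_left _ (hcov g hg)
    have hDR : ((ord.drop counts.length).map fun g => cnt prof g * D).sum = D * (N - counts.sum) := by
      rw [hR, ← List.sum_map_mul_left]
      refine congrArg List.sum (List.map_congr_left fun g _ => Nat.mul_comm _ _)
    omega
  | short =>
    intro counts hm hc
    exfalso
    simp only [CNode.check, Bool.and_eq_true, decide_eq_true_eq] at hc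
    obtain ⟨hlen, hlt⟩ := hc
    have hR := undecided_mass_eq ord hord prof hprof hm
    rw [hlen, List.drop_length] at hR
    simp at hR
    omega
  | opn pi =>
    intro counts hm hc
    simp only [CNode.check, Bool.and_eq_true, decide_eq_true_eq, List.all_eq_true, beq_iff_eq, List.mem_range] at hc
    obtain ⟨⟨⟨⟨hpi, hsum⟩, hlen⟩, hsub⟩, hcounts⟩ := hc
    refine ⟨phs.getD pi [], by rw [List.getD_eq_getElem _ _ hpi]; exact List.getElem_mem hpi, ?_⟩
    have hR := undecided_mass_eq ord hord prof hprof hm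
    rw [hsum, Nat.sub_self] at hR
    -- undecided candidates have multiplicity 0
    have hzero : ∀ g ∈ ord.drop counts.length, cnt prof g = 0 := by
      intro g hg
      have := List.single_le_sum (l := (ord.drop counts.length).map (cnt prof)) (fun _ _ => Nat.zero_le _)
        (cnt prof g) (List.mem_map.2 ⟨g, hg, rfl⟩)
      omega
    rw [List.perm_iff_count]
    intro g
    change cnt prof g = _
    by_cases hg : g ∈ ord
    · obtain ⟨j, hj, hgj⟩ := List.getElem_of_mem hg
      have hc := hcounts j hj
      rw [List.getD_eq_getElem _ _ hj, hgj] at hc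
      rw [hc]
      by_cases hjk : j < counts.length
      · have := hm.2 j hjk
        rw [List.getD_eq_getElem _ _ hj, hgj] at this
        exact this.symm
      · rw [List.getD_eq_default _ _ (by omega)]
        apply hzero
        rw [← hgj]
        exact getElem_mem_drop ord (by omega) hj
    · rw [cnt_eq_zero_of_not_mem prof hprof hg, eq_comm, List.count_eq_zero]
      exact fun h => hg (hsub g h)
  | node kids ih =>
    intro counts hm hc
    simp only [CNode.check, Bool.and_eq_true, decide_eq_true_eq] at hc
    obtain ⟨⟨hlen, hsum⟩, hall⟩ := hc
    have hR := undecided_mass_eq ord hord prof hprof hm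
    set v := cnt prof (ord.getD counts.length 0) with hv
    have hvR : v ≤ N - counts.sum := by
      rw [hR]
      have hmem : ord.getD counts.length 0 ∈ ord.drop counts.length := by
        rw [List.getD_eq_getElem _ _ hlen]
        exact getElem_mem_drop ord le_rfl hlen
      exact List.single_le_sum (fun _ _ => Nat.zero_le _) _ (List.mem_map.2 ⟨_, hmem, rfl⟩)
    have hvW : v < N + 1 := by omega
    refine ih ⟨v, hvW⟩ (counts ++ [v]) ⟨by simp; omega, fun j hj => ?_⟩ (hall ⟨v, hvW⟩ hvR)
    simp only [List.length_append, List.length_singleton] at hj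
    by_cases hjk : j < counts.length
    · rw [List.getD_append _ _ _ _ hjk]
      exact hm.2 j hjk
    · have hj' : j = counts.length := by omega
      subst hj'
      rw [List.getD_append_right _ _ _ _ le_rfl]
      simp [hv]
  | fail =>
    intro counts _ hc
    simp [CNode.check] at hc

end Sound

end Summit.Ventures.MM22.GF2Cert.Census
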